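import Mathlib
import Summits.Ventures.HodgeRepro.Tier4.Target
import Summits.Ventures.HodgeRepro.Tier4.Line3.Defs
import Summits.Ventures.HodgeRepro.Tier4.Line3.IntegralScalarExcess
import Summits.Ventures.HodgeRepro.Tier4.Line3.QuarticProfile

/-!
# Tier4/Line3/ProfileHead — the arithmetic head `(κ, δ)` of the any-degree ray display is satisfiable on every datum

Blind re-derivation cell `pub-hodge-repro`, Tier 4 «PROVE THE STEP», LINE L3, seat t4-L3-p2 (g3): C-L3-HEAD (STATUS S14871).
The any-degree ray displays (skeleton II-u, v0.51 →) open with `∃ κ δ, 0 ≤ κ ∧ 0 < δ ∧ (uniform excess gap δ) ∧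
κ · card (E →+* ℂ) < δ ∧ ProfileWindow κ xm`: with x2's uniform gap `exists_embExcess_gap` (IntegralScalarExcess; the CM
conjugation clause by `conj_emb_c`) the pair `(κ, δ) := (δ / (2 · card), δ)` satisfies the head on EVERY datum, with `κ > 0` —
so, with `ProfileWindowReach.exists_profileWindow_reach` (every `κ > 0` is reached from the four centre clauses), the
arithmetic head of the display is a theorem and the display is a bet on its analytic clauses alone.

Nothing here says anything about the status of the Hodge conjecture for CM abelian varieties, which is NOT proved
(HC_CM is NOT proved by anyone in this repository).
-/

set_option autoImplicit false

noncomputable section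

namespace Summit.Ventures.HodgeRepro.Tier4.Line3

open Summit.Ventures.HodgeRepro.Tier4
open NumberField
open scoped ComplexConjugate
open scoped Classical

namespace T4Data

variable (X : T4Data)

/-- **C-L3-HEAD**: there are `κ > 0` and `δ > 0` with the uniform excess gap `δ` on the non-norm-one algebraic integers
of `E` and `κ · card (E →+* ℂ) < δ` — `κ := δ / (2 · card)` from `exists_embExcess_gap`. -/
theorem exists_head_kappa_delta : ∃ κ δ : ℝ, 0 < κ ∧ 0 < δ ∧
    (∀ x : X.E, IsIntegral ℤ x → x ≠ 0 → X.c x * x ≠ 1 → δ ≤ embExcess x) ∧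
    κ * Fintype.card (X.E →+* ℂ) < δ := by
  obtain ⟨δ, hδ, hgap⟩ := exists_embExcess_gap (fun σ y => X.conj_emb_c σ y)
  have hcard : (0 : ℝ) < Fintype.card (X.E →+* ℂ) := by
    have : 0 < Fintype.card (X.E →+* ℂ) := Fintype.card_pos
    exact_mod_cast this
  refine ⟨δ / (2 * Fintype.card (X.E →+* ℂ)), δ, by positivity, hδ, hgap, ?_⟩
  rw [div_mul_eq_mul_div, div_lt_iff₀ (by positivity)]
  nlinarith

end T4Data

end Summit.Ventures.HodgeRepro.Tier4.Line3

end
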